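import Literature.IUT.HodgeTheaters.ThetaGeometryInhabited
import Literature.IUT.HodgeTheaters.PuncturedEllipticCoverings
import HarnessLib

/-!
# A profinite model of [IUTchI] Def. 3.1 (b)(d)(f) whose §1 datum SATISFIES the printed claims of pp. 37–38 —
# the DATA (`pedClaimsOf`, `geometryClaimsOf`); NV-L5 witness «ThetaGeometry.pe.ArrowCoveringClaims (JOINT)»,
# WITNESS-class, DEGENERATE on the π₁ side (abc-iut-L5-lead RULINGS #27 / #36 (1))

S. Mochizuki, *Inter-universal Teichmüller theory I*, RIMS manuscript (May 2020; = PRIMS **57** (2021)),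
§1 pp. 37–38 (the coverings `X̲ → X`, `C̲ → C`, the quotients `Δ_X̲ ↠ Δ_ε ↠ Δ_ε⁺ = J_X`, the section `σ` of the
cusp `2ε̲`, the cartesian diagram of `X→ → C→` over `X̲ → C̲`, `Gal(C→/C̲) ≅ ℤ/l`, `Gal(X→/C̲) ≅ ℤ/2l`), Def. 3.1
(b)(d)(f) pp. 61–63 ([IUTchI] §1 p.38) [claim: Mochizuki2012, status: disputed] (D-0012 claim key, series status
DISPUTED — this file is a MODEL of two typed INTERFACES of the cell; nothing of the series is asserted and no side is
taken on [IUTchIII] Cor. 3.12).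

## WHY (verbatim, abc-iut-L5-lead RULINGS #36 (1)): the tree had NO joint inhabitant of {ThetaGeometry fields} ∪ {pe.ArrowCoveringClaims}

Kernel finding of abc-iut-L5-t8 gen 4's RQ7 audit of p423760/p422024 (probe `not_arrowCoveringClaims_geometryOf`,
companion file `ThetaGeometryClaimsNonVacuity.lean`): the tree's only inhabitant family of abc-iut-L5-t2's
interface `ThetaGeometry GF GK l` — abc-iut-S2's `ThetaGeometryModel.geometryOf` (`ThetaGeometryInhabited.lean`:
finite factor `ℤ/2 × ℤ/l`, every cusp with decomposition group `G × {0}`) — has `Δ_X̲ = 1`, so abc-iut-L5-t1's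
predicate `PuncturedEllipticData.ArrowCoveringClaims` (FACT-LIST F-2586; clause `[Δ_X̲ : jKer] = l`) is FALSE at its
`pe`; the claims-satisfying finite datum `toyDatum` (`PuncturedEllipticCoveringsModel.lean`) has `Π_X̲ = Π_X` and is
the `pe` of no `ThetaGeometry`.  Hence the hypothesis set of abc-iut-L5-t4's (β)-input chain at good places
(`exists_localInvolution` p421621, `exists_negCompat_good` p422024, `exists_negCompat_phiEllAt` p423760 — all
conditional on `hA : D.geom.pe.ArrowCoveringClaims`) had no joint inhabitant in the tree.

## WHAT (this file = the data; the thirteen claims are proved in the proof-only companion)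

For EVERY compact totally disconnected `G_F`, closed `G_K ⊆ G_F` and `l ≥ 5` prime to `6`: finite factor
`Fin₃ l := ℤ/2 × ℤ/l × ℤ/l`; `Π_C := G × Fin₃ l ↠ G`, `Π_X := G × (0 × ℤ/l × ℤ/l)`, `Π_C̲ := G × (ℤ/2 × ℤ/l × 0)`, so
`Π_X̲ = G × (0 × ℤ/l × 0)`; cusps `ε⁰, ε′, ε″, 2ε` with `D_{ε′} = D_{ε″} := Π_X̲`, `D_{ε⁰} = D_{2ε} := G × 0` (hence
`I_{ε′} = I_{ε″} = Δ_X̲ ≅ ℤ/l`, trivial involution on `Δ_ε`, `jKer = 1`, `Π_{X→} = G × 0`, `Π_{C→} = G × (ℤ/2 × 0 × 0)`):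
`pedClaimsOf G l : PuncturedEllipticData` and `geometryClaimsOf G_K l : ThetaGeometry G_F G_K l` (`Π_{C_F} := G_F × Fin₃`,
`Π_{X_F} := G_F × (0 × ℤ/l × ℤ/l)`, the `K`-level datum embedded by the inclusion).

HONEST LABEL (RULINGS #27 (c)): `_degenerate` on the π₁ side — a joint-consistency witness for the typed interfaces,
never evidence about the curves; `Rmk121` is NOT claimed (it fails for an abelian finite factor).  A SIBLING of
abc-iut-S2's `geometryOf` with a different finite factor; nothing of `ThetaGeometryInhabited` / `PuncturedEllipticCoverings`
is edited or restated — both interfaces are consumed by name.  Not a cone member; not citable at 11:30Z/13:00Z.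
-/

noncomputable section

namespace Literature.IUT.HodgeTheaters

namespace ThetaGeometryClaimsModel

open Literature.AnabelianGeometry.AbsoluteAnabelian Topology

universe u

/-! ## The finite factor `ℤ/2 × ℤ/l × ℤ/l` -/

/-- The finite factor `ℤ/2 × ℤ/l × ℤ/l`, multiplicatively (discrete). ([IUTchI] §1 p.37) [claim: Mochizuki2012, status: disputed] -/
abbrev Fin₃ (l : ℕ) : Type :=
  Multiplicative (ZMod 2) × (Multiplicative (ZMod l) × Multiplicative (ZMod l))

section Fin
variable (l : ℕ)

/-- `0 × ℤ/l × ℤ/l` (models `Π_X ⊆ Π_C`, index `2`). ([IUTchI] §1 p.37) [claim: Mochizuki2012, status: disputed] -/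
def finX : Subgroup (Fin₃ l) := (⊥ : Subgroup (Multiplicative (ZMod 2))).prod ⊤

/-- `ℤ/2 × ℤ/l × 0` (models `Π_C̲ ⊆ Π_C`, index `l`). ([IUTchI] §1 p.37) [claim: Mochizuki2012, status: disputed] -/
def finC : Subgroup (Fin₃ l) :=
  (⊤ : Subgroup (Multiplicative (ZMod 2))).prod ((⊤ : Subgroup (Multiplicative (ZMod l))).prod ⊥)

/-- `0 × ℤ/l × 0` (models `Π_X̲ = Π_X ∩ Π_C̲`). ([IUTchI] §1 p.37) [claim: Mochizuki2012, status: disputed] -/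
def finXbar : Subgroup (Fin₃ l) :=
  (⊥ : Subgroup (Multiplicative (ZMod 2))).prod ((⊤ : Subgroup (Multiplicative (ZMod l))).prod ⊥)

/-- `ℤ/2 × 0 × 0` (the `l`-th powers of `Δ_C̲`: `Gal(X̲/C̲)`). ([IUTchI] §1 p.38) [claim: Mochizuki2012, status: disputed] -/
def finGal : Subgroup (Fin₃ l) :=
  (⊤ : Subgroup (Multiplicative (ZMod 2))).prod ((⊥ : Subgroup (Multiplicative (ZMod l))).prod ⊥)

variable {l}

/-- Membership in `0 × ℤ/l × ℤ/l`. ([IUTchI] §1 p.37) [claim: Mochizuki2012, status: disputed] -/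
@[simp] theorem mem_finX {x : Fin₃ l} : x ∈ finX l ↔ x.1 = 1 := by
  simp only [finX, Subgroup.mem_prod, Subgroup.mem_bot, Subgroup.mem_top, and_true]

/-- Membership in `ℤ/2 × ℤ/l × 0`. ([IUTchI] §1 p.37) [claim: Mochizuki2012, status: disputed] -/
@[simp] theorem mem_finC {x : Fin₃ l} : x ∈ finC l ↔ x.2.2 = 1 := by
  simp only [finC, Subgroup.mem_prod, Subgroup.mem_bot, Subgroup.mem_top, true_and]

/-- Membership in `0 × ℤ/l × 0`. ([IUTchI] §1 p.37) [claim: Mochizuki2012, status: disputed] -/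
@[simp] theorem mem_finXbar {x : Fin₃ l} : x ∈ finXbar l ↔ x.1 = 1 ∧ x.2.2 = 1 := by
  simp only [finXbar, Subgroup.mem_prod, Subgroup.mem_bot, Subgroup.mem_top, true_and]

/-- Membership in `ℤ/2 × 0 × 0`. ([IUTchI] §1 p.37) [claim: Mochizuki2012, status: disputed] -/
@[simp] theorem mem_finGal {x : Fin₃ l} : x ∈ finGal l ↔ x.2.1 = 1 ∧ x.2.2 = 1 := by
  simp only [finGal, Subgroup.mem_prod, Subgroup.mem_bot, Subgroup.mem_top, true_and]

/-- `Π_X̲`-part `≤ Π_X`-part. ([IUTchI] §1 p.37) [claim: Mochizuki2012, status: disputed] -/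
theorem finXbar_le_finX : finXbar l ≤ finX l := fun _ hx => mem_finX.mpr (mem_finXbar.mp hx).1

/-- `Π_X̲`-part `≤ Π_C̲`-part. ([IUTchI] §1 p.37) [claim: Mochizuki2012, status: disputed] -/
theorem finXbar_le_finC : finXbar l ≤ finC l := fun _ hx => mem_finC.mpr (mem_finXbar.mp hx).2

/-- `Π_X ∩ Π_C̲ = Π_X̲` in the finite factor. ([IUTchI] §1 p.37) [claim: Mochizuki2012, status: disputed] -/
theorem finX_inf_finC : finX l ⊓ finC l = finXbar l := by
  ext x
  simp only [Subgroup.mem_inf, mem_finX, mem_finC, mem_finXbar]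

variable (l)

/-- `Nat.card (ℤ/n) = n` in multiplicative notation. [folklore] -/
private theorem card_mult_zmod (n : ℕ) : Nat.card (Multiplicative (ZMod n)) = n := by
  rw [Nat.card_congr Multiplicative.toAdd, Nat.card_zmod]

/-- `[Fin₃ : 0 × ℤ/l × ℤ/l] = 2`. ([IUTchI] §1 p.37) [claim: Mochizuki2012, status: disputed] -/
theorem finX_index [NeZero l] : (finX l).index = 2 := by
  simp only [finX, Subgroup.index_prod, Subgroup.index_bot, Subgroup.index_top, card_mult_zmod, mul_one]

/-- `[Fin₃ : ℤ/2 × ℤ/l × 0] = l`. ([IUTchI] §1 p.37) [claim: Mochizuki2012, status: disputed] -/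
theorem finC_index [NeZero l] : (finC l).index = l := by
  simp only [finC, Subgroup.index_prod, Subgroup.index_top, Subgroup.index_bot, card_mult_zmod, one_mul]

/-- `[Fin₃ : 0 × ℤ/l × 0] = 2l`. ([IUTchI] §1 p.37) [claim: Mochizuki2012, status: disputed] -/
theorem finXbar_index [NeZero l] : (finXbar l).index = 2 * l := by
  simp only [finXbar, Subgroup.index_prod, Subgroup.index_top, Subgroup.index_bot, card_mult_zmod, one_mul]

end Fin

/-! ## Subgroups `G × D` of `G × Fin₃ l` -/

section Lift

variable (G : Type u) [Group G] (l : ℕ)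

/-- `G × D` for a subgroup `D` of the finite factor. ([IUTchI] §1 p.37) [claim: Mochizuki2012, status: disputed] -/
def lift (D : Subgroup (Fin₃ l)) : Subgroup (G × Fin₃ l) := (⊤ : Subgroup G).prod D

variable {G l}

/-- Membership in `G × D` is membership of the second component in `D`. ([IUTchI] §1 p.37) [claim: Mochizuki2012, status: disputed] -/
@[simp] theorem mem_lift {D : Subgroup (Fin₃ l)} {x : G × Fin₃ l} : x ∈ lift G l D ↔ x.2 ∈ D := by
  simp [lift, Subgroup.mem_prod]

variable (G l)

/-- `[G × Fin₃ : G × D] = [Fin₃ : D]`. ([IUTchI] §1 p.37) [claim: Mochizuki2012, status: disputed] -/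
theorem lift_index (D : Subgroup (Fin₃ l)) : (lift G l D).index = D.index := by
  rw [lift, Subgroup.index_prod, Subgroup.index_top, one_mul]

/-- `G × D` is monotone in `D`. ([IUTchI] §1 p.37) [claim: Mochizuki2012, status: disputed] -/
theorem lift_mono {D D' : Subgroup (Fin₃ l)} (h : D ≤ D') : lift G l D ≤ lift G l D' :=
  fun _ hx => mem_lift.mpr (h (mem_lift.mp hx))

/-- `(G × D) ∩ (G × D') = G × (D ∩ D')`. ([IUTchI] §1 p.37) [claim: Mochizuki2012, status: disputed] -/
theorem lift_inf (D D' : Subgroup (Fin₃ l)) : lift G l D ⊓ lift G l D' = lift G l (D ⊓ D') := by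
  ext x; simp [Subgroup.mem_inf]

/-- `[G × D' : G × D] · [Fin₃ : D'] = [Fin₃ : D]` for `D ≤ D'`. ([IUTchI] §1 p.37) [claim: Mochizuki2012, status: disputed] -/
theorem lift_relIndex {D D' : Subgroup (Fin₃ l)} (h : D ≤ D') [NeZero l] :
    (lift G l D).relIndex (lift G l D') * D'.index = D.index := by
  rw [← lift_index G l D', ← lift_index G l D, Subgroup.relIndex_mul_index (lift_mono G l h)]

/-- `G × D ↠ G` under the first projection. ([IUTchI] §1 p.37) [claim: Mochizuki2012, status: disputed] -/
theorem fst_lift_surjective (D : Subgroup (Fin₃ l)) :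
    Function.Surjective ((MonoidHom.fst G (Fin₃ l)).comp (lift G l D).subtype) := by
  intro g
  exact ⟨⟨(g, 1), by simp⟩, rfl⟩

/-- `G × D` is open (the finite factor is discrete). ([IUTchI] §1 p.37) [claim: Mochizuki2012, status: disputed] -/
theorem isOpen_lift [TopologicalSpace G] (D : Subgroup (Fin₃ l)) : IsOpen (lift G l D : Set (G × Fin₃ l)) := by
  have : (lift G l D : Set (G × Fin₃ l)) = Prod.snd ⁻¹' (D : Set (Fin₃ l)) := by ext x; simp
  rw [this]; exact (isOpen_discrete (D : Set (Fin₃ l))).preimage continuous_snd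

/-- In `G × Fin₃` the commutator of any `g` with an element `x` of the geometric part `{1} × Fin₃` is trivial (the
finite factor is abelian) — condition (∗) of [IUTchI] §1. ([IUTchI] §1 p.37) [claim: Mochizuki2012, status: disputed] -/
theorem comm_eq_one_of_fst_eq_one (g x : G × Fin₃ l) (hx : x.1 = 1) : g * x * g⁻¹ * x⁻¹ = 1 := by
  obtain ⟨σ, d'⟩ := g
  obtain ⟨τ, d⟩ := x
  simp only at hx
  subst hx
  refine Prod.ext ?_ ?_
  · show σ * 1 * σ⁻¹ * 1⁻¹ = 1
    rw [mul_one, mul_inv_cancel, inv_one, mul_one]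
  · show d' * d * d'⁻¹ * d⁻¹ = 1
    rw [mul_inv_eq_one, mul_inv_eq_iff_eq_mul, mul_comm]

/-- `G × D` is normal (the finite factor is abelian). ([IUTchI] §1 p.37) [claim: Mochizuki2012, status: disputed] -/
theorem lift_normal (D : Subgroup (Fin₃ l)) : (lift G l D).Normal := by
  haveI : D.Normal := ⟨fun a ha b => by rwa [mul_comm b a, mul_inv_cancel_right]⟩
  exact Subgroup.prod_normal ⊤ D

end Lift

/-! ## The model `Π_C ↠ G` and its §1 datum -/

section Model

variable (G : Type u) [Group G] [TopologicalSpace G] [IsTopologicalGroup G] [CompactSpace G]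
  [TotallyDisconnectedSpace G] (l : ℕ) [NeZero l]

/-- The model extension `G × (ℤ/2 × ℤ/l × ℤ/l) ↠ G` (first projection): `Π_C ↠ G_k` with geometric part
`Δ_C = {1} × Fin₃ l`. ([IUTchI] Def 3.1 p.61) [claim: Mochizuki2012, status: disputed] -/
def extOf : FundamentalExtension.{u} where
  arith := ProfiniteGrp.of (G × Fin₃ l)
  gal := ProfiniteGrp.of G
  aug := ContinuousMonoidHom.fst G (Fin₃ l)
  aug_surjective := Prod.fst_surjective

/-- `Δ_C = {1} × Fin₃` in the model. ([IUTchI] §1 p.37) [claim: Mochizuki2012, status: disputed] -/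
@[simp] theorem mem_geom_extOf {x : G × Fin₃ l} : x ∈ (extOf G l).geom ↔ x.1 = 1 :=
  FundamentalExtension.mem_geom _

end Model

section Decomp

variable (G : Type u) [Group G] (l : ℕ)

/-- The decomposition groups of the four cusps: `D_{ε′} = D_{ε″} := Π_X̲ = G × (0 × ℤ/l × 0)`, `D_{ε⁰} = D_{2ε} := G × 0`.
([IUTchI] §1 p.37) [claim: Mochizuki2012, status: disputed] -/
def decompOf (x : ULift.{u} (Fin 4)) : Subgroup (G × Fin₃ l) :=
  if x = ⟨1⟩ ∨ x = ⟨2⟩ then lift G l (finXbar l) else lift G l ⊥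

/-- Every decomposition group lies in `Π_X̲`. ([IUTchI] §1 p.37) [claim: Mochizuki2012, status: disputed] -/
theorem decompOf_le (x : ULift.{u} (Fin 4)) : decompOf G l x ≤ lift G l (finXbar l) := by
  unfold decompOf; split_ifs; exacts [le_rfl, lift_mono G l bot_le]

/-- The cusps other than `ε′, ε″` have decomposition group `G × 0`. ([IUTchI] §1 p.37) [claim: Mochizuki2012, status: disputed] -/
theorem decompOf_of_ne {x : ULift.{u} (Fin 4)} (h1 : x ≠ ⟨1⟩) (h2 : x ≠ ⟨2⟩) : decompOf G l x = lift G l ⊥ := by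
  unfold decompOf; rw [if_neg (not_or.mpr ⟨h1, h2⟩)]

end Decomp

section Model

variable (G : Type u) [Group G] [TopologicalSpace G] [IsTopologicalGroup G] [CompactSpace G]
  [TotallyDisconnectedSpace G] (l : ℕ) [NeZero l]

/-- **The claims-satisfying model of [IUTchI] §1's data over `G`** (`PuncturedEllipticData`): `Π_C := G × (ℤ/2 × ℤ/l × ℤ/l)`,
`Π_X := G × (0 × ℤ/l × ℤ/l)`, `Π_C̲ := G × (ℤ/2 × ℤ/l × 0)`, cusps `ε⁰, ε′, ε″, 2ε` with decomposition groups
`G × 0, Π_X̲, Π_X̲, G × 0`.  DEGENERATE on the π₁ side (abelian finite factor) — an interface model, not a curve.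
([IUTchI] §1 p.37) [claim: Mochizuki2012, status: disputed] -/
def pedClaimsOf (h5 : 5 ≤ l) (h6 : l.Coprime 6) : PuncturedEllipticData.{u} where
  l := l
  five_le := h5
  coprime_six := h6
  E := extOf G l
  PiX := lift G l (finX l)
  PiCbar := lift G l (finC l)
  isOpen_piX := isOpen_lift G l (finX l)
  isOpen_piCbar := isOpen_lift G l (finC l)
  index_piX := (lift_index G l (finX l)).trans (finX_index l)
  aug_piX := fst_lift_surjective G l (finX l)
  aug_piCbar := fst_lift_surjective G l (finC l)
  star := by
    intro g _ x hx
    have h1 : x.1 = 1 := (mem_geom_extOf G l).mp hx.2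
    have h0 : g * x * g⁻¹ * x⁻¹ = 1 := comm_eq_one_of_fst_eq_one G l g x h1
    rw [h0]
    exact Subgroup.one_mem _
  Cusp := ULift.{u} (Fin 4)
  decomp := decompOf G l
  decomp_le := fun x =>
    le_inf ((decompOf_le G l x).trans (lift_mono G l finXbar_le_finX))
      ((decompOf_le G l x).trans (lift_mono G l finXbar_le_finC))
  ε0 := ⟨0⟩
  ε1 := ⟨1⟩
  ε2 := ⟨2⟩
  twoε := ⟨3⟩
  ε1_ne_ε0 := by decide
  ε2_ne_ε0 := by decide
  ε1_ne_ε2 := by decide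
  twoε_ne := by decide
  aug_decomp_twoε := by
    show Function.Surjective ((MonoidHom.fst G (Fin₃ l)).comp (decompOf G l ⟨3⟩).subtype)
    rw [decompOf_of_ne G l (by decide) (by decide)]
    exact fst_lift_surjective G l ⊥

end Model
/-! ## The construction of pp. 37–38 evaluated at the model -/

section Claims

variable (G : Type u) [Group G] [TopologicalSpace G] [IsTopologicalGroup G] [CompactSpace G]
  [TotallyDisconnectedSpace G] (l : ℕ) [NeZero l] (h5 : 5 ≤ l) (h6 : l.Coprime 6)

/-- `l` of the model. ([IUTchI] §1 p.37) [claim: Mochizuki2012, status: disputed] -/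
@[simp] theorem pedClaimsOf_l : (pedClaimsOf G l h5 h6).l = l := rfl

/-- `Π_X̲ = G × (0 × ℤ/l × 0)`. ([IUTchI] §1 p.37) [claim: Mochizuki2012, status: disputed] -/
theorem piXbar_eq : (pedClaimsOf G l h5 h6).PiXbar = lift G l (finXbar l) := by
  show lift G l (finX l) ⊓ lift G l (finC l) = lift G l (finXbar l)
  rw [lift_inf, finX_inf_finC]

/-- `Δ_C = {1} × Fin₃`. ([IUTchI] §1 p.37) [claim: Mochizuki2012, status: disputed] -/
theorem mem_deltaC {x : G × Fin₃ l} : x ∈ (pedClaimsOf G l h5 h6).DeltaC ↔ x.1 = 1 :=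
  mem_geom_extOf G l

end Claims

/-! ## The Def 3.1 datum `ThetaGeometry G_F G_K l` over the claims-satisfying §1 datum -/

section Theta

variable {GF : Type u} [Group GF] [TopologicalSpace GF] [IsTopologicalGroup GF] [CompactSpace GF]
  [TotallyDisconnectedSpace GF] (GK : Subgroup GF) (l : ℕ) [NeZero l]

omit [NeZero l] in
/-- The image of `G × D` under the first projection is all of `G`. ([IUTchI] §1 p.37) [claim: Mochizuki2012, status: disputed] -/
theorem map_fst_lift (G : Type u) [Group G] (D : Subgroup (Fin₃ l)) :
    (lift G l D).map (MonoidHom.fst G (Fin₃ l)) = ⊤ :=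
  eq_top_iff.mpr fun g _ => ⟨(g, 1), mem_lift.mpr (Subgroup.one_mem _), rfl⟩

/-- **The claims-satisfying profinite model of the `π₁`-interface of [IUTchI] Def. 3.1 (b)(d)(f)** for a compact
totally disconnected `G_F`, a closed subgroup `G_K` and `l ≥ 5` prime to `6`: `Π_{C_F} := G_F × (ℤ/2 × ℤ/l × ℤ/l)` over
`G_F` by the first projection, `Π_{X_F} := G_F × (0 × ℤ/l × ℤ/l)`, the `K`-level §1 datum `pedClaimsOf G_K l` embedded
by the inclusion.  Every `ThetaGeometry` field holds; the `pe` satisfies `ArrowCoveringClaims` (companion file).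
DEGENERATE π₁-side MODEL. ([IUTchI] Def 3.1 p.61) [claim: Mochizuki2012, status: disputed] -/
def geometryClaimsOf (hGK : IsClosed (GK : Set GF)) (h5 : 5 ≤ l) (h6 : l.Coprime 6) : ThetaGeometry GF GK l :=
  letI : CompactSpace GK := isCompact_iff_compactSpace.mp hGK.isCompact
  { extF := extOf GF l
    galIso := MulEquiv.refl GF
    galIso_continuous := ⟨continuous_id, continuous_id⟩
    PiX := lift GF l (finX l)
    PiX_isOpen := isOpen_lift GF l (finX l)
    PiX_normal := lift_normal GF l (finX l)
    PiX_index := (lift_index GF l (finX l)).trans (finX_index l)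
    aug_PiX := map_fst_lift l GF (finX l)
    pe := pedClaimsOf GK l h5 h6
    pe_l := rfl
    embK := MonoidHom.prodMap GK.subtype (MonoidHom.id (Fin₃ l))
    embK_continuous := continuous_subtype_val.prodMap continuous_id
    embK_injective := by
      rintro ⟨a, b⟩ ⟨c, d⟩ h
      have h1 := congrArg Prod.fst h
      have h2 := congrArg Prod.snd h
      exact Prod.ext (Subtype.ext h1) h2
    embK_range := by
      ext x
      constructor
      · rintro ⟨y, rfl⟩
        exact y.1.property
      · intro hx
        have hx' : x.1 ∈ GK := hx
        exact ⟨(⟨x.1, hx'⟩, x.2), Prod.ext rfl rfl⟩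
    galKIso := MulEquiv.refl GK
    aug_compat := fun _ => rfl
    embK_PiX := by
      ext x
      constructor
      · rintro ⟨y, hmem, rfl⟩
        exact ⟨mem_lift.mpr (mem_lift.mp hmem), y, rfl⟩
      · rintro ⟨hmem, y, hy⟩
        have h2 : y.2 = x.2 := congrArg Prod.snd hy
        refine ⟨y, mem_lift.mpr ?_, hy⟩
        rw [h2]
        exact mem_lift.mp hmem
    PiXbar_relIndex := by
      rw [piXbar_eq]
      have h := lift_relIndex GK l (finXbar_le_finX (l := l))
      rw [finX_index, finXbar_index] at h
      show (lift GK l (finXbar l)).relIndex (lift GK l (finX l)) = l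
      omega
    aug_PiXbar := by
      rw [piXbar_eq]
      exact fst_lift_surjective GK l (finXbar l)
    PiXbar_relIndex_PiCbar := by
      rw [piXbar_eq]
      have h := lift_relIndex GK l (finXbar_le_finC (l := l))
      rw [finC_index, finXbar_index] at h
      show (lift GK l (finXbar l)).relIndex (lift GK l (finC l)) = 2
      have hl : 0 < l := NeZero.pos l
      nlinarith [h, hl]
    not_PiCbar_le_PiX := by
      intro h
      have hmem : ((1 : GK), (Multiplicative.ofAdd (1 : ZMod 2),
          ((1 : Multiplicative (ZMod l)), (1 : Multiplicative (ZMod l))))) ∈ lift GK l (finC l) :=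
        mem_lift.mpr (mem_finC.mpr rfl)
      have h2 := mem_finX.mp (mem_lift.mp (h hmem))
      exact absurd (Multiplicative.ofAdd.injective h2) (by decide) }

/-- The `pe` of the model IS the claims datum `pedClaimsOf G_K l`. ([IUTchI] Def 3.1 p.62) [claim: Mochizuki2012, status: disputed] -/
theorem geometryClaimsOf_pe (hGK : IsClosed (GK : Set GF)) (h5 : 5 ≤ l) (h6 : l.Coprime 6) :
    haveI : CompactSpace GK := isCompact_iff_compactSpace.mp hGK.isCompact
    (geometryClaimsOf GK l hGK h5 h6).pe = pedClaimsOf GK l h5 h6 := rfl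

end Theta

end ThetaGeometryClaimsModel

end Literature.IUT.HodgeTheaters

end
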